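import Mathlib
import HarnessLib

/-!
# QUANT lane R8, front "FAR beyond trees", layer one — THE DEGREE-THREE GATE AT THE OBSERVER, LXXVIII: the FIVE-CELL cover lemma
# for a gate with NO outside relay (`A = {v, u₁, u₂}`)

builds on p205010 (kernel theorem, internal audit signed; external expert review pending)

Support file (`--supports stmt-CriticalPhenomena-4575`), seat `prim-quant-p1` (gen 38); memo
`run/shared/lean/prim/quant/prim-quant-p1-g38/FOR-LEAD-GATE3-ZERO.md`.  Mathlib-only real algebra; standard axioms; no sorries; no definitions.

THE POINT.  `Quant.farLayerOne_of_gate3` (file LXXVII, p1 g37) carries the structural hypothesis `hout : 1 ≤ #(A ∖ {v,u₁,u₂})` — at least one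
relay outside the gate — only because the fifteen-cell cover lemma of files XIII/XX is organised around the outside count.  When there is NO
outside relay (`A = {v, u₁, u₂}`, so the row is an instance of `Z(3,2)`), the law of the gate lives on the FIVE environment types
`a = [o, u₁, u₂ pairwise apart off v]`, `b₁ = [o ~ u₁ only]`, `b₂ = [o ~ u₂ only]`, `c = [u₁ ~ u₂, o apart]`, `d = [o ~ u₁ ~ u₂]`
(`Gate3Cells`), and the row is the pure-real statement `Gate3.cover_zero` below: for `p, r₁, r₂ ∈ [0,1]` (the three gate weights), five
non-negative cells of total mass one, ONE union-Harris row `P(¬G₁)·P(¬G₂ ∧ ¬H) ≤ P(apart)` (`= a·d ≥ b₁(b₂ + c)`), the three cuts `≤ t` and the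
mean `> 2`, the five-type bound of `Gate3.real_card_le_one_le` for `P(N ≤ 1)` is `≤ t`.

PROOF (closed form, no certificates).  With `P_i = p + (1−p)r_i`, `Π = (1−r₁)(1−r₂)`, the three differences "bound minus cut" are
`Π·(p(a+c) − (1−p)d)`, `(1−r₁)·((1−p)b₁ − P₂b₂ − p r₂ a)`, `(1−r₂)·((1−p)b₂ − P₁b₁ − p r₁ a)`; if one is `≤ 0` we are done, otherwise
`b₁, b₂ > 0`, `p < 1/2`, `P₁P₂ < (1−p)²`, and Harris × the first two give `P_i b_i² ≤ p(a+c)²`; then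
`(1−p)·(Σ cuts − 1) ≥ (a+c)·F(p,r₁,r₂) ≥ 0` with `F = 2 − 6p + 3p² + 3p(1−p)Π − (1−p)(¼+2p)·[(P₁(1+r₂)−1)⁺ + (P₂(1+r₁)−1)⁺]`
(`Gate3.paramA/B/C`, elementary: the true supremum of the mean over violators is `3/2`, attained at the star `p = ½`, `r → 0`), contradicting
the mean `> 2`.  [cite: KozmaNitzan2024, Conjecture 3 (p. 15)]; [cite: Grimmett1999, §2.2, Thm. (2.4) p. 34]; [this work].
-/

noncomputable section

namespace Summit.CriticalPhenomena.PercolationContinuityZ3.Theorems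

namespace Quant

namespace Gate3

/-- Parameter inequality, case A (both bracket terms non-positive): `0 ≤ 2 − 6p + 3p² + 3p(1−p)Π` for `p < 1/2` under the
violators' constraint `P₁P₂ < (1−p)²`. [this work] -/
theorem paramA_zero (p r₁ r₂ : ℝ) (hp0 : 0 ≤ p) (hp1 : p ≤ 1) (hr10 : 0 ≤ r₁) (hr11 : r₁ ≤ 1) (hr20 : 0 ≤ r₂) (hr21 : r₂ ≤ 1)
    (hC : (p + (1 - p) * r₁) * (p + (1 - p) * r₂) < (1 - p) ^ 2) :
    0 ≤ 2 - 6 * p + 3 * p ^ 2 + 3 * p * (1 - p) * ((1 - r₁) * (1 - r₂)) := by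
  have h1p : (0 : ℝ) ≤ 1 - p := sub_nonneg.2 hp1
  have hPi : 0 ≤ p * (1 - p) * ((1 - r₁) * (1 - r₂)) :=
    mul_nonneg (mul_nonneg hp0 h1p) (mul_nonneg (sub_nonneg.2 hr11) (sub_nonneg.2 hr21))
  by_cases hp25 : p ≤ 2 / 5
  · have h35 : (3 : ℝ) / 5 * (3 / 5) ≤ (1 - p) * (1 - p) :=
      mul_self_le_mul_self (by norm_num) (by linarith)
    nlinarith [h35, hPi]
  · push Not at hp25
    have hrr : 0 ≤ (1 - p) * (r₁ * r₂) := mul_nonneg h1p (mul_nonneg hr10 hr20)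
    nlinarith [hC, hrr]

/-- The key estimate of a positive bracket term: if `P₁P₂ < (1−p)²` and `p < 1/2` then `(1−p)(P₁(1+r₂) − 1) < 1 − 3p + p²`. [this work] -/
theorem bracket_lt_zero (p r₁ r₂ : ℝ) (hp1 : p ≤ 1) (hr11 : r₁ ≤ 1) (hph : p < 1 / 2)
    (hC : (p + (1 - p) * r₁) * (p + (1 - p) * r₂) < (1 - p) ^ 2) :
    (1 - p) * ((p + (1 - p) * r₁) * (1 + r₂) - 1) < 1 - 3 * p + p ^ 2 := by
  have hP1 : (p + (1 - p) * r₁) - 1 ≤ 0 := by nlinarith [mul_nonneg (sub_nonneg.2 hp1) (sub_nonneg.2 hr11)]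
  have hfac : 0 ≤ -(((p + (1 - p) * r₁) - 1) * (1 - 2 * p)) := by
    have := mul_nonpos_of_nonpos_of_nonneg hP1 (by linarith : (0 : ℝ) ≤ 1 - 2 * p)
    linarith
  nlinarith [hC, hfac]

/-- From a positive bracket term: `p < 2/5`. [this work] -/
theorem p_lt_two_fifths_zero (p r₁ r₂ : ℝ) (hp1 : p ≤ 1) (hr11 : r₁ ≤ 1) (hph : p < 1 / 2)
    (hC : (p + (1 - p) * r₁) * (p + (1 - p) * r₂) < (1 - p) ^ 2) (hpos : 1 < (p + (1 - p) * r₁) * (1 + r₂)) :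
    p < 2 / 5 := by
  have h1 := bracket_lt_zero p r₁ r₂ hp1 hr11 hph hC
  have h2 : 0 < (1 - p) * ((p + (1 - p) * r₁) * (1 + r₂) - 1) := mul_pos (by linarith) (by linarith)
  by_contra h
  push Not at h
  have h3 : 0 ≤ (p - 2 / 5) * (1 / 2 - p) := mul_nonneg (by linarith) (by linarith)
  nlinarith [h1, h2, h3]

/-- Parameter inequality, case B (one bracket term positive): [this work] -/
theorem paramB_zero (p r₁ r₂ : ℝ) (hp0 : 0 ≤ p) (hp1 : p ≤ 1) (hr11 : r₁ ≤ 1) (hr21 : r₂ ≤ 1)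
    (hph : p < 1 / 2) (hC : (p + (1 - p) * r₁) * (p + (1 - p) * r₂) < (1 - p) ^ 2)
    (hpos : 1 < (p + (1 - p) * r₁) * (1 + r₂)) :
    0 ≤ 2 - 6 * p + 3 * p ^ 2 + 3 * p * (1 - p) * ((1 - r₁) * (1 - r₂)) -
      (1 - p) * (1 / 4 + 2 * p) * ((p + (1 - p) * r₁) * (1 + r₂) - 1) := by
  have h1p : (0 : ℝ) ≤ 1 - p := sub_nonneg.2 hp1
  have hPi : 0 ≤ p * (1 - p) * ((1 - r₁) * (1 - r₂)) :=
    mul_nonneg (mul_nonneg hp0 h1p) (mul_nonneg (sub_nonneg.2 hr11) (sub_nonneg.2 hr21))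
  have h1 := bracket_lt_zero p r₁ r₂ hp1 hr11 hph hC
  have hp25 := p_lt_two_fifths_zero p r₁ r₂ hp1 hr11 hph hC hpos
  have h2 : (1 / 4 + 2 * p) * ((1 - p) * ((p + (1 - p) * r₁) * (1 + r₂) - 1)) ≤ (1 / 4 + 2 * p) * (1 - 3 * p + p ^ 2) :=
    mul_le_mul_of_nonneg_left h1.le (by linarith)
  have hcub : 0 ≤ p ^ 2 * (2 / 5 - p) := mul_nonneg (sq_nonneg p) (by linarith)
  have hg : 0 ≤ 7 / 4 - 29 / 4 * p + 35 / 4 * p ^ 2 - 2 * p ^ 3 := by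
    nlinarith [sq_nonneg (p - 9 / 20), hcub]
  nlinarith [h2, hg, hPi]

/-- Parameter inequality, case C (both bracket terms present; only the first need be positive): [this work] -/
theorem paramC_zero (p r₁ r₂ : ℝ) (hp0 : 0 ≤ p) (hp1 : p ≤ 1) (hr11 : r₁ ≤ 1) (hr21 : r₂ ≤ 1)
    (hph : p < 1 / 2) (hC : (p + (1 - p) * r₁) * (p + (1 - p) * r₂) < (1 - p) ^ 2)
    (hpos1 : 1 < (p + (1 - p) * r₁) * (1 + r₂)) :
    0 ≤ 2 - 6 * p + 3 * p ^ 2 + 3 * p * (1 - p) * ((1 - r₁) * (1 - r₂)) -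
      (1 - p) * (1 / 4 + 2 * p) * (((p + (1 - p) * r₁) * (1 + r₂) - 1) + ((p + (1 - p) * r₂) * (1 + r₁) - 1)) := by
  have h1p : (0 : ℝ) ≤ 1 - p := sub_nonneg.2 hp1
  have hPi : 0 ≤ p * (1 - p) * ((1 - r₁) * (1 - r₂)) :=
    mul_nonneg (mul_nonneg hp0 h1p) (mul_nonneg (sub_nonneg.2 hr11) (sub_nonneg.2 hr21))
  have hC' : (p + (1 - p) * r₂) * (p + (1 - p) * r₁) < (1 - p) ^ 2 := by linarith [hC]
  have h1 := bracket_lt_zero p r₁ r₂ hp1 hr11 hph hC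
  have h1' := bracket_lt_zero p r₂ r₁ hp1 hr21 hph hC'
  have hp25 := p_lt_two_fifths_zero p r₁ r₂ hp1 hr11 hph hC hpos1
  have h2 : (1 / 4 + 2 * p) * ((1 - p) * ((p + (1 - p) * r₁) * (1 + r₂) - 1)) ≤ (1 / 4 + 2 * p) * (1 - 3 * p + p ^ 2) :=
    mul_le_mul_of_nonneg_left h1.le (by linarith)
  have h2' : (1 / 4 + 2 * p) * ((1 - p) * ((p + (1 - p) * r₂) * (1 + r₁) - 1)) ≤ (1 / 4 + 2 * p) * (1 - 3 * p + p ^ 2) :=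
    mul_le_mul_of_nonneg_left h1'.le (by linarith)
  have hcub : 0 ≤ p ^ 2 * (2 / 5 - p) := mul_nonneg (sq_nonneg p) (by linarith)
  have hh : 0 ≤ 3 / 2 - 17 / 2 * p + 29 / 2 * p ^ 2 - 4 * p ^ 3 := by
    nlinarith [sq_nonneg (p - 33 / 100), hcub]
  nlinarith [h2, h2', hh, hPi]

/-- **The five-cell cover lemma for a degree-three gate with NO outside relay** (A = {v, u₁, u₂}): from the five environment cells, one
union-Harris row, the three cuts `≤ t` and the mean `> 2`, the five-type bound for `P(N ≤ 1)` is `≤ t`. [this work] -/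
theorem cover_zero (p r₁ r₂ : ℝ) (hp0 : 0 ≤ p) (hp1 : p ≤ 1) (hr10 : 0 ≤ r₁) (hr11 : r₁ ≤ 1) (hr20 : 0 ≤ r₂) (hr21 : r₂ ≤ 1)
    (t a b₁ b₂ c d : ℝ) (ha : 0 ≤ a) (hb1 : 0 ≤ b₁) (hb2 : 0 ≤ b₂) (hc : 0 ≤ c)
    (hsum : a + b₁ + b₂ + c + d = 1)
    (hH1 : ((a + c) + b₂) * (a + b₁) ≤ a)
    (hcutv : (1 - p) * (r₁ * r₂) * (a + c) + (1 - p) * (r₁ * (1 - r₂)) * ((a + c) + b₂) +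
        (1 - p) * ((1 - r₁) * r₂) * ((a + c) + b₁) + (1 - p) * ((1 - r₁) * (1 - r₂)) ≤ t)
    (hcut1 : p * ((1 - r₁) * r₂) * (a + b₂) + (1 - p) * (r₁ * r₂) * (a + c) +
        (p * ((1 - r₁) * (1 - r₂)) + (1 - p) * (r₁ * (1 - r₂)) + (1 - p) * ((1 - r₁) * r₂) + (1 - p) * ((1 - r₁) * (1 - r₂))) *
          ((a + c) + b₂) ≤ t)
    (hcut2 : p * ((1 - r₂) * r₁) * (a + b₁) + (1 - p) * (r₂ * r₁) * (a + c) +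
        (p * ((1 - r₂) * (1 - r₁)) + (1 - p) * (r₂ * (1 - r₁)) + (1 - p) * ((1 - r₂) * r₁) + (1 - p) * ((1 - r₂) * (1 - r₁))) *
          ((a + c) + b₁) ≤ t)
    (hEN : 2 < (1 - ((1 - p) * (r₁ * r₂) * (a + c) + (1 - p) * (r₁ * (1 - r₂)) * ((a + c) + b₂) +
        (1 - p) * ((1 - r₁) * r₂) * ((a + c) + b₁) + (1 - p) * ((1 - r₁) * (1 - r₂)))) +
      (1 - (p * ((1 - r₁) * r₂) * (a + b₂) + (1 - p) * (r₁ * r₂) * (a + c) +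
        (p * ((1 - r₁) * (1 - r₂)) + (1 - p) * (r₁ * (1 - r₂)) + (1 - p) * ((1 - r₁) * r₂) + (1 - p) * ((1 - r₁) * (1 - r₂))) *
          ((a + c) + b₂))) +
      (1 - (p * ((1 - r₂) * r₁) * (a + b₁) + (1 - p) * (r₂ * r₁) * (a + c) +
        (p * ((1 - r₂) * (1 - r₁)) + (1 - p) * (r₂ * (1 - r₁)) + (1 - p) * ((1 - r₂) * r₁) + (1 - p) * ((1 - r₂) * (1 - r₁))) *
          ((a + c) + b₁)))) :
    p * ((1 - r₁) * (1 - r₂)) * (a + c) + (1 - p) * (r₁ * r₂) * (a + c) + (1 - p) * (r₁ * (1 - r₂)) * ((a + c) + b₂) +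
        (1 - p) * ((1 - r₁) * r₂) * ((a + c) + b₁) + (1 - p) * ((1 - r₁) * (1 - r₂)) * (((a + c) + b₂) + b₁) ≤ t := by
  by_contra hcon
  push Not at hcon
  have h1p : (0 : ℝ) ≤ 1 - p := sub_nonneg.2 hp1
  have h1r1 : (0 : ℝ) ≤ 1 - r₁ := sub_nonneg.2 hr11
  have h1r2 : (0 : ℝ) ≤ 1 - r₂ := sub_nonneg.2 hr21
  have hPi0 : 0 ≤ (1 - r₁) * (1 - r₂) := mul_nonneg h1r1 h1r2
  have hs1 : (1 - p) * ((1 - r₁) * (1 - r₂)) * (a + b₁ + b₂ + c + d) = (1 - p) * ((1 - r₁) * (1 - r₂)) := by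
    rw [hsum, mul_one]
  -- the three differences "bound − cut" are positive
  have hDv : 0 < ((1 - r₁) * (1 - r₂)) * (p * (a + c) - (1 - p) * d) := by linarith [hcutv, hcon, hs1]
  have hD1 : 0 < (1 - r₁) * ((1 - p) * b₁ - (p + (1 - p) * r₂) * b₂ - p * r₂ * a) := by linarith [hcut1, hcon]
  have hD2 : 0 < (1 - r₂) * ((1 - p) * b₂ - (p + (1 - p) * r₁) * b₁ - p * r₁ * a) := by linarith [hcut2, hcon]
  obtain ⟨-, hV1⟩ : 0 < (1 - r₁) * (1 - r₂) ∧ 0 < p * (a + c) - (1 - p) * d := by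
    rcases pos_and_pos_or_neg_and_neg_of_mul_pos hDv with h | h
    · exact h
    · exact absurd h.1 (not_lt.2 hPi0)
  obtain ⟨-, hV2⟩ : 0 < 1 - r₁ ∧ 0 < (1 - p) * b₁ - (p + (1 - p) * r₂) * b₂ - p * r₂ * a := by
    rcases pos_and_pos_or_neg_and_neg_of_mul_pos hD1 with h | h
    · exact h
    · exact absurd h.1 (not_lt.2 h1r1)
  obtain ⟨-, hV3⟩ : 0 < 1 - r₂ ∧ 0 < (1 - p) * b₂ - (p + (1 - p) * r₁) * b₁ - p * r₁ * a := by
    rcases pos_and_pos_or_neg_and_neg_of_mul_pos hD2 with h | h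
    · exact h
    · exact absurd h.1 (not_lt.2 h1r2)
  -- positivity of `b₁, b₂`, `p < 1/2`
  have hP1 : 0 ≤ p + (1 - p) * r₁ := add_nonneg hp0 (mul_nonneg h1p hr10)
  have hP2 : 0 ≤ p + (1 - p) * r₂ := add_nonneg hp0 (mul_nonneg h1p hr20)
  have hP1b1 : 0 ≤ (p + (1 - p) * r₁) * b₁ := mul_nonneg hP1 hb1
  have hP2b2 : 0 ≤ (p + (1 - p) * r₂) * b₂ := mul_nonneg hP2 hb2
  have hpr1a : 0 ≤ p * r₁ * a := mul_nonneg (mul_nonneg hp0 hr10) ha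
  have hpr2a : 0 ≤ p * r₂ * a := mul_nonneg (mul_nonneg hp0 hr20) ha
  have hb1pos : 0 < b₁ := by
    by_contra h
    push Not at h
    have hb10 : b₁ = 0 := le_antisymm h hb1
    rw [hb10, mul_zero] at hV2
    linarith
  have hb2pos : 0 < b₂ := by
    by_contra h
    push Not at h
    have hb20 : b₂ = 0 := le_antisymm h hb2
    rw [hb20, mul_zero] at hV3
    linarith
  have hph : p < 1 / 2 := by
    by_contra h
    push Not at h
    have f1 : 0 ≤ (1 - p) * r₂ * b₂ := mul_nonneg (mul_nonneg h1p hr20) hb2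
    have f2 : 0 ≤ (1 - p) * r₁ * b₁ := mul_nonneg (mul_nonneg h1p hr10) hb1
    have f3 : 0 ≤ (2 * p - 1) * b₂ := mul_nonneg (by linarith) hb2
    have f4 : 0 ≤ (2 * p - 1) * b₁ := mul_nonneg (by linarith) hb1
    linarith [hV2, hV3, f1, f2, f3, f4]
  have h1ppos : (0 : ℝ) < 1 - p := by linarith
  -- the two ratio bounds and the constraint `P₁P₂ < (1−p)²`
  have hq1 : (p + (1 - p) * r₁) * b₁ < (1 - p) * b₂ := by linarith [hV3]
  have hq2 : (p + (1 - p) * r₂) * b₂ < (1 - p) * b₁ := by linarith [hV2]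
  have hC : (p + (1 - p) * r₁) * (p + (1 - p) * r₂) < (1 - p) ^ 2 := by
    have hm := mul_lt_mul'' hq1 hq2 hP1b1 hP2b2
    have hbb : 0 < b₁ * b₂ := mul_pos hb1pos hb2pos
    by_contra h
    push Not at h
    have h' := mul_le_mul_of_nonneg_right h hbb.le
    linarith [hm, h']
  -- Harris: `c·b₁ + b₁·b₂ ≤ a·d`
  have hsa : a * (a + b₁ + b₂ + c + d) = a := by rw [hsum, mul_one]
  have hHar : c * b₁ + b₁ * b₂ ≤ a * d := by linarith [hH1, hsa]
  have hbb_ad : b₁ * b₂ ≤ a * d := by linarith [hHar, mul_nonneg hc hb1]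
  -- `P_i b_i² ≤ p (a+c)²`
  have s3 : ((1 - p) * d) * a ≤ (p * (a + c)) * a := mul_le_mul_of_nonneg_right (by linarith [hV1]) ha
  have s4 : p * (a + c) * a ≤ p * (a + c) * (a + c) :=
    mul_le_mul_of_nonneg_left (by linarith) (mul_nonneg hp0 (by linarith))
  have s2 : (1 - p) * (b₁ * b₂) ≤ (1 - p) * (a * d) := mul_le_mul_of_nonneg_left hbb_ad h1p
  have hb1sq : (p + (1 - p) * r₁) * (b₁ * b₁) ≤ p * ((a + c) * (a + c)) := by
    have s1 : (p + (1 - p) * r₁) * b₁ * b₁ ≤ (1 - p) * b₂ * b₁ := mul_le_mul_of_nonneg_right hq1.le hb1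
    linarith [s1, s2, s3, s4]
  have hb2sq : (p + (1 - p) * r₂) * (b₂ * b₂) ≤ p * ((a + c) * (a + c)) := by
    have s1 : (p + (1 - p) * r₂) * b₂ * b₂ ≤ (1 - p) * b₁ * b₂ := mul_le_mul_of_nonneg_right hq2.le hb2
    linarith [s1, s2, s3, s4]
  -- common pieces of the final estimate
  have hx0 : 0 ≤ a + c := add_nonneg ha hc
  have hK0 : 0 ≤ (a + c) * (1 / 4 + 2 * p) := mul_nonneg hx0 (by linarith)
  have hPi1 : (1 - r₁) * (1 - r₂) ≤ 1 := mul_le_one₀ (by linarith) h1r2 (by linarith)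
  have hcd0 : 0 ≤ 1 - (1 - p) * ((1 - r₁) * (1 - r₂)) := by
    have h := mul_le_mul (by linarith : 1 - p ≤ 1) hPi1 hPi0 zero_le_one
    linarith
  have hs2 : (1 - p) * (1 - (1 - p) * ((1 - r₁) * (1 - r₂))) * (a + b₁ + b₂ + c + d) =
      (1 - p) * (1 - (1 - p) * ((1 - r₁) * (1 - r₂))) := by rw [hsum, mul_one]
  have S1 : 0 ≤ (1 - p) * (a * (p * (r₁ * (1 - r₂) + r₂ * (1 - r₁)))) :=
    mul_nonneg h1p (mul_nonneg ha (mul_nonneg hp0 (add_nonneg (mul_nonneg hr10 h1r2) (mul_nonneg hr20 h1r1))))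
  have S2 : (1 - p) * d * (1 - (1 - p) * ((1 - r₁) * (1 - r₂))) ≤ p * (a + c) * (1 - (1 - p) * ((1 - r₁) * (1 - r₂))) :=
    mul_le_mul_of_nonneg_right (by linarith [hV1]) hcd0
  -- square-root-free bound `b_i ≤ (a+c)(1/4 + 2p)` when the bracket term is positive
  have root : ∀ (P b : ℝ), 0 ≤ b → 1 < P * 2 → P * (b * b) ≤ p * ((a + c) * (a + c)) → b ≤ (a + c) * (1 / 4 + 2 * p) := by
    intro P b hb hP hsq
    have hsq2 : b * b ≤ ((a + c) * (1 / 4 + 2 * p)) * ((a + c) * (1 / 4 + 2 * p)) := by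
      have e1 : 0 ≤ (P * 2 - 1) * (b * b) := mul_nonneg (by linarith) (mul_nonneg hb hb)
      have e2 : 0 ≤ (a + c) * (a + c) * ((2 * p - 1 / 4) * (2 * p - 1 / 4)) :=
        mul_nonneg (mul_nonneg hx0 hx0) (mul_self_nonneg _)
      linarith [e1, hsq, e2]
    by_contra h
    push Not at h
    linarith [mul_self_lt_mul_self hK0 h, hsq2]
  -- (1-p)·(Σ cuts − 1) ≥ 0, by the four sign cases
  have key : 0 ≤ (1 - p) * (((1 - p) * (r₁ * r₂) * (a + c) + (1 - p) * (r₁ * (1 - r₂)) * ((a + c) + b₂) +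
        (1 - p) * ((1 - r₁) * r₂) * ((a + c) + b₁) + (1 - p) * ((1 - r₁) * (1 - r₂))) +
      (p * ((1 - r₁) * r₂) * (a + b₂) + (1 - p) * (r₁ * r₂) * (a + c) +
        (p * ((1 - r₁) * (1 - r₂)) + (1 - p) * (r₁ * (1 - r₂)) + (1 - p) * ((1 - r₁) * r₂) + (1 - p) * ((1 - r₁) * (1 - r₂))) *
          ((a + c) + b₂)) +
      (p * ((1 - r₂) * r₁) * (a + b₁) + (1 - p) * (r₂ * r₁) * (a + c) +
        (p * ((1 - r₂) * (1 - r₁)) + (1 - p) * (r₂ * (1 - r₁)) + (1 - p) * ((1 - r₂) * r₁) + (1 - p) * ((1 - r₂) * (1 - r₁))) *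
          ((a + c) + b₁)) - 1) := by
    by_cases hpos1 : (p + (1 - p) * r₁) * (1 + r₂) ≤ 1
    · have B1 : (1 - p) * (b₁ * ((p + (1 - p) * r₁) * (1 + r₂) - 1)) ≤ 0 :=
        mul_nonpos_of_nonneg_of_nonpos h1p (mul_nonpos_of_nonneg_of_nonpos hb1 (by linarith))
      by_cases hpos2 : (p + (1 - p) * r₂) * (1 + r₁) ≤ 1
      · have B2 : (1 - p) * (b₂ * ((p + (1 - p) * r₂) * (1 + r₁) - 1)) ≤ 0 :=
          mul_nonpos_of_nonneg_of_nonpos h1p (mul_nonpos_of_nonneg_of_nonpos hb2 (by linarith))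
        have hF := mul_nonneg hx0 (paramA_zero p r₁ r₂ hp0 hp1 hr10 hr11 hr20 hr21 hC)
        linarith [hs2, S1, S2, B1, B2, hF]
      · push Not at hpos2
        have hb2le := root _ _ hb2 (by linarith [hpos2, mul_nonneg hP2 h1r1]) hb2sq
        have B2 : (1 - p) * (b₂ * ((p + (1 - p) * r₂) * (1 + r₁) - 1)) ≤
            (1 - p) * (((a + c) * (1 / 4 + 2 * p)) * ((p + (1 - p) * r₂) * (1 + r₁) - 1)) :=
          mul_le_mul_of_nonneg_left (mul_le_mul_of_nonneg_right hb2le (by linarith)) h1p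
        have hC' : (p + (1 - p) * r₂) * (p + (1 - p) * r₁) < (1 - p) ^ 2 := by linarith [hC]
        have hF := mul_nonneg hx0 (paramB_zero p r₂ r₁ hp0 hp1 hr21 hr11 hph hC' hpos2)
        linarith [hs2, S1, S2, B1, B2, hF]
    · push Not at hpos1
      have hb1le := root _ _ hb1 (by linarith [hpos1, mul_nonneg hP1 h1r2]) hb1sq
      have B1 : (1 - p) * (b₁ * ((p + (1 - p) * r₁) * (1 + r₂) - 1)) ≤
          (1 - p) * (((a + c) * (1 / 4 + 2 * p)) * ((p + (1 - p) * r₁) * (1 + r₂) - 1)) :=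
        mul_le_mul_of_nonneg_left (mul_le_mul_of_nonneg_right hb1le (by linarith)) h1p
      by_cases hpos2 : (p + (1 - p) * r₂) * (1 + r₁) ≤ 1
      · have B2 : (1 - p) * (b₂ * ((p + (1 - p) * r₂) * (1 + r₁) - 1)) ≤ 0 :=
          mul_nonpos_of_nonneg_of_nonpos h1p (mul_nonpos_of_nonneg_of_nonpos hb2 (by linarith))
        have hF := mul_nonneg hx0 (paramB_zero p r₁ r₂ hp0 hp1 hr11 hr21 hph hC hpos1)
        linarith [hs2, S1, S2, B1, B2, hF]
      · push Not at hpos2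
        have hb2le := root _ _ hb2 (by linarith [hpos2, mul_nonneg hP2 h1r1]) hb2sq
        have B2 : (1 - p) * (b₂ * ((p + (1 - p) * r₂) * (1 + r₁) - 1)) ≤
            (1 - p) * (((a + c) * (1 / 4 + 2 * p)) * ((p + (1 - p) * r₂) * (1 + r₁) - 1)) :=
          mul_le_mul_of_nonneg_left (mul_le_mul_of_nonneg_right hb2le (by linarith)) h1p
        have hF := mul_nonneg hx0 (paramC_zero p r₁ r₂ hp0 hp1 hr11 hr21 hph hC hpos1)
        linarith [hs2, S1, S2, B1, B2, hF]
  -- contradiction with the mean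
  have hY : 0 ≤ ((1 - p) * (r₁ * r₂) * (a + c) + (1 - p) * (r₁ * (1 - r₂)) * ((a + c) + b₂) +
        (1 - p) * ((1 - r₁) * r₂) * ((a + c) + b₁) + (1 - p) * ((1 - r₁) * (1 - r₂))) +
      (p * ((1 - r₁) * r₂) * (a + b₂) + (1 - p) * (r₁ * r₂) * (a + c) +
        (p * ((1 - r₁) * (1 - r₂)) + (1 - p) * (r₁ * (1 - r₂)) + (1 - p) * ((1 - r₁) * r₂) + (1 - p) * ((1 - r₁) * (1 - r₂))) *
          ((a + c) + b₂)) +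
      (p * ((1 - r₂) * r₁) * (a + b₁) + (1 - p) * (r₂ * r₁) * (a + c) +
        (p * ((1 - r₂) * (1 - r₁)) + (1 - p) * (r₂ * (1 - r₁)) + (1 - p) * ((1 - r₂) * r₁) + (1 - p) * ((1 - r₂) * (1 - r₁))) *
          ((a + c) + b₁)) - 1 := by
    by_contra h
    push Not at h
    have := mul_neg_of_pos_of_neg h1ppos h
    linarith
  linarith
    
end Gate3

end Quant

end Summit.CriticalPhenomena.PercolationContinuityZ3.Theorems
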